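import Summits.QuantumFields.YangMills.Theorems.UnitScaleTiltProp7TubeStrGaugeComparison
import Summits.QuantumFields.YangMills.Theorems.UnitScaleTiltProp7TubeComparisonKnitOfRegPr
import HarnessLib

/-!
# Route `UnitScaleTilt`, crux «MinimiserStabilityRegPr» (stmt-QuantumFields-19200, stub EX), γ-row `hGF[Lift]` (LOD line, ★p1 g24 LOCATE-L6-ASSEMBLY v1 §1 Step I.2),
# pen (L5), piece (L5c) — FILE B: ★★★ THE AVERAGING OPERATOR OF RECORD AT A PRINTED-REGULAR BACKGROUND IS, IN `ℓ²`, A UNITARILY FRAMED COPY OF THE FLAT ONE APPLIED TO THE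
# GAUGED FIELD: `Σ_{c'} ‖QTwS U₀ B c' − Ad_{w(c')} QTwS 1 B^g c'‖² ≤ (3·10¹⁰L¹⁰ε₀² + 192(ℓδ)²)·ℓ^{2−d}·Σ_b ‖B b‖²` (su(2) carriers; `g` any unitary gauge, `δ`-flat along the live walks)

Cell `ym3-torus` (rung R3 — YM₃ on T³; NOT d = 4, NOT the Clay problem).  Width seat `ym-routeR-w4` g25 (CLAIM «MINE (L5)» 2026-08-29 22:56Z on ★p1 g24's LOCATE «HANDS WANTED (L5)»).
THEOREMS ONLY (0 `def`, 0 `sorry`); `--supports stmt-QuantumFields-19200 --as helper`; count-neutral.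

THE POINT.  With `ℓ = L^{K−n}`, `η = ℓ⁻¹`, (L5c) of the LOCATE reads `a·|‖Q_k(U₀)A_j‖² − ‖Q_k(1)A_j^{g_j}‖²| ≤ C(ε₀R″)‖A_j‖²` for a field supported in a cube on whose concentric cube the
axial gauge `g_j` makes `U₀` `δ = 6R″ε₀η`-flat.  Since `Q_k = η • toL2B ∘ QTwS ∘ toL2⁻¹` (✓`Prop7SectET3CurvedPropagators.Qk`, ✓`QL2_toL2`) and `Ad_w` is a pointwise isometry of `M₂`,
everything is in the CARRIER row proved here: for EVERY 𝔰𝔲(2) bond field `B` (no support hypothesis) and every unitary gauge `g`,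
`QTwS U₀ B c' = Ad_{w(c')}·QTwS 1 B^g c' + (three errors)`, `w(c') = Φ(ĉ)⁻¹·g(x₀(ĉ))⁻¹` (`Φ` = the (iv) frame, `x₀(ĉ)` the block corner), `B^g(b) = Ad_{g(b₋)}B(b)`; the errors are
(R2)+(R3) `QTwS U₀ B = G_Λ B ≈ S B` [✓p746096 ∕ ✓p748472, `E₂ ≤ (10¹¹L¹⁰∕16)ε₀²ℓ^{2−d}` by ✓`bridgeConst_sq_le`], (R1) `ℓ^d·Ad_Φ S ≈ T^{str}_{U₀}B` [✓p748544, `10⁹L⁴ε₀²ℓ^dℓ²`], and the local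
gauge comparison `T^{str}_{U₀}B = Ad_{g(x₀)}⁻¹T^{str}_{U₀^g}B^g ≈ Ad_{g(x₀)}⁻¹·(plain tube sum of B^g) = Ad_{g(x₀)}⁻¹·ℓ^d·QTwS 1 B^g` [FILE A ✓`Prop7TubeStrGaugeComparison`,
`(8ℓδ)²ℓ^dℓ²`], the last one needing `U₀^g` `δ`-flat ONLY on the comb∕run walks of the tube terms where `B ≠ 0` (hypothesis `hgood`, discharged by the (L6) assembler from its cube
letters).  `(a + b + c)² ≤ 3(a² + b² + c²)` and reindexing `c' ↦ ĉ = bondShift c'` finish.  With `δℓ = 6R″ε₀` the constant is `C(L)·(1 + R″²)·ε₀²·ℓ^{2−d}`, level-uniform in the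
`Q_k`-currency (`η²·cB∕c₀ = ℓ^{d−2}` at the pins of CARD §5).
HONEST SCOPE.  Bookkeeping over landed rows (no estimate of print beyond them); the `Q_k`∕`L²` reading, (L5a)∕(L5b), (L5″), (L6), the seams, `hGF`, the print rows, `hThm2S`, EX and the crux
are NOT proved here.
References: T. Bałaban, CMP **99** (1985) 389–434 [Balaban1985BackgroundPropagators] ((3.13)–(3.15) p.393, Thm 3.11 p.416); CMP **98** (1985) 17–51 [Balaban1985Averaging]
(Prop. 3 (124)–(126) p.36, Prop. 4 (134)–(135) p.38); CMP **95** (1984) 17–40 [Balaban1984PropagatorsI] ((1.18)–(1.20) pp.19–20); CMP **102** (1985) 277–309 [Balaban1985Variational] ((51) p.286).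
-/

set_option autoImplicit false

noncomputable section

open scoped BigOperators Matrix.Norms.L2Operator Matrix

namespace Summit.QuantumFields.YangMills.Theorems.Prop7QTwSLocalGaugeComparison

open Literature.MathematicalPhysics.QuantumFieldTheory.Balaban1983to89
open Literature.MathematicalPhysics.QuantumFieldTheory.Balaban1983to89.T3ContinuumYM3Torus
open Finset T4Continuum BlockAveraging AveragingRT ExpMeanLog BlockAveragingEMLLinearised BlockAveragingEMLLinearisedBackground BlockAveragingEMLProp2 LatticeFieldCalculus
open B1RG242Torus
open B7Prop1Explicit (U1 mem_U1 treeWord expUnit disp)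
open B7Prop2Explicit (unitaryUnits unitaryUnits_le_U1)
open B7Eq78Linearization (conjR conjR_apply conjR_sub conjR_smul)
open B8Ineq132 (norm_conjR conjR_conjR one_conjR conjR_sum)
open B10Eq27TorusAxialLog (holT axialT gaugeActT gaugeActT_apply unitsField toUField transl)
open B15DeterminingSets (embIter)
open T3LevelShift (bondShift)
open T3PrintedRegularOrbits (sites_eq)
open T3PrintedRegularMinimiser (RegPr)
open T3SectALandauChart (bgUnits)
open Summit.QuantumFields.YangMills.Theorems.Prop8Chart (emlIterU)
open Summit.QuantumFields.YangMills.Theorems.Prop7SymAvgTwSym (QTwS holT_mem_U1 unitsField_toUField_mem_U1')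
open Summit.QuantumFields.YangMills.Theorems.Prop7NestedMeanTowerCloseness (rel_corner_fibreSite)
open Summit.QuantumFields.YangMills.Theorems.Prop7TubeTransportCloseness (walkEnd_replicate_true)
open Summit.QuantumFields.YangMills.Theorems.Prop7TubeComparisonRowFlat (iterate_shift_eq_runSite)
open Summit.QuantumFields.YangMills.Theorems.Prop7TubeStrSubStairLineIter (sum_normSq_tubeStr_sub_smul_conjR_lineIter_le axialT_bg_mem_unitaryUnits)
open Summit.QuantumFields.YangMills.Theorems.Prop7TrueLinIterDefectOfStairGauge (sqrt_sum_normSq_frameReduced_sub_lineIter_le_of_regPr)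
open Summit.QuantumFields.YangMills.Theorems.Prop7CoarseGaugeEqFrameResponseQTwS (exists_stairGauge_family QTwS_apply_eq_frameReduced_bondShift)
open Summit.QuantumFields.YangMills.Theorems.Prop7TubeComparisonKnitOfRegPr (bridgeConst_sq_le)
open Summit.QuantumFields.YangMills.Theorems.Prop7TubeStrGaugeComparison (conjR_holT_mul_holT_eq_gauge sum_normSq_tubeStr_sub_plain_le plainTube_eq_smul_QTwS_one)

variable (F : T3Family) (n K : ℕ)

/-! ## §1 The three-error identity and its norm -/

/-- The bookkeeping identity behind FILE B: with `T = Ad_{g₀}⁻¹ T_V` and `PL = ℓ • Q₁`,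
`ℓ • G − Ad_{Φ⁻¹g₀⁻¹}(ℓ • Q₁) = ℓ • (G − S) − Ad_{Φ⁻¹}(T − ℓ • Ad_Φ S) + Ad_{Φ⁻¹g₀⁻¹}(T_V − PL)`. [cite: Balaban1985BackgroundPropagators, (3.13)-(3.15) p.393] -/
theorem three_error_identity (Φ g₀ : (Matrix (Fin 2) (Fin 2) ℂ)ˣ) (ld : ℂ) (G S T TV PL Q₁ : Matrix (Fin 2) (Fin 2) ℂ) (hT : T = conjR g₀⁻¹ TV) (hPL : PL = ld • Q₁) :
    ld • G - conjR (Φ⁻¹ * g₀⁻¹) (ld • Q₁)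
      = ld • (G - S) - conjR Φ⁻¹ (T - ld • conjR Φ S) + conjR (Φ⁻¹ * g₀⁻¹) (TV - PL) := by
  rw [hT, hPL, conjR_sub, conjR_sub, conjR_smul, conjR_smul, conjR_conjR, conjR_conjR, inv_mul_cancel, one_conjR, smul_sub]
  abel

set_option maxHeartbeats 400000 in
/-- … hence `‖ℓ • G − Ad_{Φ⁻¹g₀⁻¹}(ℓ • Q₁)‖² ≤ 3·(‖ℓ • (G − S)‖² + ‖T − ℓ • Ad_Φ S‖² + ‖T_V − PL‖²)` for contractive `Φ`, `g₀`. [cite: Balaban1985Averaging, (19)-(20) p.21] -/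
theorem normSq_three_error_le {Φ g₀ : (Matrix (Fin 2) (Fin 2) ℂ)ˣ} (hΦ : Φ ∈ U1 (Matrix (Fin 2) (Fin 2) ℂ)) (hg₀ : g₀ ∈ U1 (Matrix (Fin 2) (Fin 2) ℂ)) (ld : ℂ) (G S T TV PL Q₁ : Matrix (Fin 2) (Fin 2) ℂ)
    (hT : T = conjR g₀⁻¹ TV) (hPL : PL = ld • Q₁) :
    ‖ld • G - conjR (Φ⁻¹ * g₀⁻¹) (ld • Q₁)‖ ^ 2 ≤ 3 * (‖ld • (G - S)‖ ^ 2 + ‖T - ld • conjR Φ S‖ ^ 2 + ‖TV - PL‖ ^ 2) := by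
  rw [three_error_identity Φ g₀ ld G S T TV PL Q₁ hT hPL]
  have hΦi : Φ⁻¹ ∈ U1 (Matrix (Fin 2) (Fin 2) ℂ) := (U1 _).inv_mem hΦ
  have hw : Φ⁻¹ * g₀⁻¹ ∈ U1 (Matrix (Fin 2) (Fin 2) ℂ) := (U1 _).mul_mem hΦi ((U1 _).inv_mem hg₀)
  have h1 : ‖ld • (G - S) - conjR Φ⁻¹ (T - ld • conjR Φ S) + conjR (Φ⁻¹ * g₀⁻¹) (TV - PL)‖
      ≤ ‖ld • (G - S)‖ + ‖T - ld • conjR Φ S‖ + ‖TV - PL‖ := by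
    calc _ ≤ ‖ld • (G - S) - conjR Φ⁻¹ (T - ld • conjR Φ S)‖ + ‖conjR (Φ⁻¹ * g₀⁻¹) (TV - PL)‖ := norm_add_le _ _
      _ ≤ (‖ld • (G - S)‖ + ‖conjR Φ⁻¹ (T - ld • conjR Φ S)‖) + ‖conjR (Φ⁻¹ * g₀⁻¹) (TV - PL)‖ := by gcongr; exact norm_sub_le _ _
      _ = _ := by rw [norm_conjR hΦi, norm_conjR hw]
  have h0 : 0 ≤ ‖ld • (G - S)‖ + ‖T - ld • conjR Φ S‖ + ‖TV - PL‖ := by positivity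
  have h2 := pow_le_pow_left₀ (norm_nonneg _) h1 2
  nlinarith [h2, sq_nonneg (‖ld • (G - S)‖ - ‖T - ld • conjR Φ S‖), sq_nonneg (‖T - ld • conjR Φ S‖ - ‖TV - PL‖), sq_nonneg (‖ld • (G - S)‖ - ‖TV - PL‖)]

variable (h : n ≤ K)

/-! ## §2 ★★★ (L5c) in carrier letters -/

set_option maxHeartbeats 400000 in
/-- ★★★ **THE AVERAGING OPERATOR OF RECORD AT `U₀` vs THE FLAT ONE ON THE GAUGED FIELD, IN `ℓ²` OVER THE COARSE BONDS.**  `RegPr F n K ε₀ U₀`, `10¹⁰L⁶ε₀ ≤ 1`, `10¹²L³ε₀ ≤ 1`;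
`g` a contractive (`U1`-valued, e.g. unitary) gauge transformation, `δ ≥ 0`; `B` an 𝔰𝔲(2)-valued bond field such that for every top bond `c`, offset `r` and `t < ℓ` with `B(b_{r,t}(c)) ≠ 0` the gauged background
`U₀^g = gaugeActT g U₀♭` is `δ`-close to `1` on every bond of the comb `x₀(c) → x_r` and of the run `x_r → x_r + te` (`hgood`).  Then, with `B^g(b) = Ad_{g(b₋)}B(b)`, the (iv) frame
`Φ(ĉ) = axialT U₀♭ x₀(ĉ) (embIter (K−n) ĉ₋)` and `w(c') = Φ(ĉ)⁻¹·g(x₀(ĉ))⁻¹` (`ĉ = bondShift (sites_eq F n K h) c'`):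
`Σ_{c'} ‖QTwS U₀ B c' − Ad_{w(c')}(QTwS 1 B^g c')‖² ≤ (3·10¹⁰·L¹⁰·ε₀² + 192·(ℓδ)²)·(ℓ²∕ℓ^d)·Σ_b ‖B b‖²`.
PROOF: (R3) ✓`QTwS_apply_eq_frameReduced_bondShift` (`Q`, `Λ` as `Nat.rec`∕`∃`), (R2) ✓`sqrt_sum_normSq_frameReduced_sub_lineIter_le_of_regPr` squared + ✓`bridgeConst_sq_le`,
(R1) ✓`sum_normSq_tubeStr_sub_smul_conjR_lineIter_le`, FILE A ✓`conjR_holT_mul_holT_eq_gauge` ∕ ✓`sum_normSq_tubeStr_sub_plain_le` ∕ ✓`plainTube_eq_smul_QTwS_one`, §1, reindexing.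
[cite: Balaban1985BackgroundPropagators, (3.13)-(3.15) p.393, Thm 3.11 p.416; Balaban1985Averaging, Prop. 3 (124)-(126) p.36, Prop. 4 (134)-(135) p.38; Balaban1984PropagatorsI, (1.18)-(1.20) pp.19-20] -/
theorem sum_normSq_QTwS_sub_conjR_QTwS_one_gauge_le {ε₀ : ℝ} (hε₀ : 0 < ε₀) (hε : 10 ^ 10 * (F.L : ℝ) ^ 6 * ε₀ ≤ 1) (hε12 : 10 ^ 12 * (F.L : ℝ) ^ 3 * ε₀ ≤ 1)
    (W : GaugeField (F.P K) 0 (Matrix.specialUnitaryGroup (Fin 2) ℂ)) (hreg : RegPr F n K ε₀ W)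
    (g : Site (F.P K) 0 → (Matrix (Fin 2) (Fin 2) ℂ)ˣ) (hg : ∀ x, g x ∈ U1 (Matrix (Fin 2) (Fin 2) ℂ)) {δ : ℝ} (hδ : 0 ≤ δ)
    (B : PBond (F.P K) 0 → Matrix (Fin 2) (Fin 2) ℂ) (hsk : ∀ b, (B b)ᴴ = -B b) (htr : ∀ b, (B b).trace = 0)
    (hgood : ∀ (c : PBond (F.P K) (K - n)) (r : Fin (F.P K).d → Fin ((F.P K).L ^ (K - n))) (t : ℕ), t < (F.P K).L ^ (K - n) →
      B ⟨(fun z : Site (F.P K) 0 => z.shift c.dir)^[t] (Site.fibreSite 0 (K - n) c.src r), c.dir⟩ ≠ 0 →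
        (∀ st ∈ walk (Site.fibreSite 0 (K - n) c.src fun _ => (⟨0, pow_pos (F.P K).L_pos (K - n)⟩ : Fin ((F.P K).L ^ (K - n)))) (treeWord fun ν => ((r ν : ℕ) : ℤ)),
            ‖(((gaugeActT g (unitsField (toUField W))) st.bond : (Matrix (Fin 2) (Fin 2) ℂ)ˣ) : Matrix (Fin 2) (Fin 2) ℂ) - 1‖ ≤ δ) ∧
        (∀ st ∈ walk (Site.fibreSite 0 (K - n) c.src r) (List.replicate t (c.dir, true)),
            ‖(((gaugeActT g (unitsField (toUField W))) st.bond : (Matrix (Fin 2) (Fin 2) ℂ)ˣ) : Matrix (Fin 2) (Fin 2) ℂ) - 1‖ ≤ δ)) :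
    ∑ c' : PBond (F.P n) 0, ‖QTwS F n K h W B c'
        - conjR ((axialT (unitsField (toUField W)) (Site.fibreSite 0 (K - n) (bondShift (sites_eq F n K h) c').src fun _ => (⟨0, pow_pos (F.P K).L_pos (K - n)⟩ : Fin ((F.P K).L ^ (K - n)))) (embIter (K - n) (bondShift (sites_eq F n K h) c').src))⁻¹ * (g (Site.fibreSite 0 (K - n) (bondShift (sites_eq F n K h) c').src fun _ => (⟨0, pow_pos (F.P K).L_pos (K - n)⟩ : Fin ((F.P K).L ^ (K - n)))))⁻¹)
            (QTwS F n K h (1 : GaugeField (F.P K) 0 (Matrix.specialUnitaryGroup (Fin 2) ℂ)) (fun b => conjR (g b.src) (B b)) c')‖ ^ 2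
      ≤ (3 * 10 ^ 10 * (F.L : ℝ) ^ 10 * ε₀ ^ 2 + 192 * ((F.L : ℝ) ^ (K - n) * δ) ^ 2)
          * (((F.L : ℝ) ^ (K - n)) ^ 2 / ((F.L : ℝ) ^ (K - n)) ^ (F.P K).d) * ∑ b : PBond (F.P K) 0, ‖B b‖ ^ 2 := by
  classical
  have hk : K - n ≤ (F.P K).m + (F.P K).K := by show K - n ≤ F.m + K; omega
  have hd : (F.P K).d = 3 := T3Family.P_d F K
  have hLL : ((F.P K).L : ℝ) = F.L := rfl
  have hL3 : (3 : ℝ) ≤ F.L := by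
    have h3 : 3 ≤ F.L := by obtain ⟨a, ha⟩ := F.hL.1; have := F.hL.2; omega
    exact_mod_cast h3
  have hL0 : (0 : ℝ) < F.L := by linarith
  have hℓ0 : (0 : ℝ) < (F.L : ℝ) ^ (K - n) := by positivity
  have hℓd0 : (0 : ℝ) < ((F.L : ℝ) ^ (K - n)) ^ (F.P K).d := by positivity
  -- the gauged field
  set Bg : PBond (F.P K) 0 → Matrix (Fin 2) (Fin 2) ℂ := fun b => conjR (g b.src) (B b) with hBg
  have hU1 : ∀ b, (unitsField (toUField W)) b ∈ U1 (Matrix (Fin 2) (Fin 2) ℂ) := fun b => unitsField_toUField_mem_U1' W b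
  have hg1 : ∀ x, g x ∈ U1 (Matrix (Fin 2) (Fin 2) ℂ) := hg
  have hV1 : ∀ b, (gaugeActT g (unitsField (toUField W))) b ∈ U1 (Matrix (Fin 2) (Fin 2) ℂ) := fun b => by
    rw [gaugeActT_apply]; exact (U1 _).mul_mem ((U1 _).mul_mem (hg1 _) (hU1 b)) ((U1 _).inv_mem (hg1 _))
  have hBgn : ∀ b, ‖Bg b‖ = ‖B b‖ := fun b => norm_conjR (hg1 _) (B b)
  have hΦ1 : ∀ c : PBond (F.P K) (K - n), (axialT (unitsField (toUField W)) (Site.fibreSite 0 (K - n) c.src fun _ => (⟨0, pow_pos (F.P K).L_pos (K - n)⟩ : Fin ((F.P K).L ^ (K - n)))) (embIter (K - n) c.src)) ∈ U1 (Matrix (Fin 2) (Fin 2) ℂ) := fun c => by unfold axialT; exact holT_mem_U1 hU1 _ _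
  have hA : ∀ b, B b ∈ skewAdjoint (Matrix (Fin 2) (Fin 2) ℂ) := fun b => by rw [skewAdjoint.mem_iff]; exact hsk b
  -- the pure `LINE` family, the true-linearisation family, the stair gauges, the frame-reduced response (as in ✓`Prop7TubeComparisonKnitOfRegPr`)
  let Sf : (k : ℕ) → PBond (F.P K) k → Matrix (Fin 2) (Fin 2) ℂ := fun k =>
    Nat.rec (motive := fun k => PBond (F.P K) k → Matrix (Fin 2) (Fin 2) ℂ) B
      (fun k Sk => fun c => ((Fintype.card (Idx (F.P K)) : ℂ))⁻¹ • ∑ i : Idx (F.P K),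
          (((holAt (Averaging.iter (fun i => blockAvg (P := F.P K) (j := i) (expMeanLogSU (n := Fin 2))) k W) (walk (emb c.src) (stairWord i.2.1 (off i.1))) : Matrix.specialUnitaryGroup (Fin 2) ℂ) : Matrix (Fin 2) (Fin 2) ℂ) *
            covWalkSum (Averaging.iter (fun i => blockAvg (P := F.P K) (j := i) (expMeanLogSU (n := Fin 2))) k W) (Sk)
              (walk (walkEnd (emb c.src) (stairWord i.2.1 (off i.1))) (List.replicate (F.P K).L (c.dir, true))) *
          star ((holAt (Averaging.iter (fun i => blockAvg (P := F.P K) (j := i) (expMeanLogSU (n := Fin 2))) k W) (walk (emb c.src) (stairWord i.2.1 (off i.1))) : Matrix.specialUnitaryGroup (Fin 2) ℂ) : Matrix (Fin 2) (Fin 2) ℂ))) k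
  let Qf : (k : ℕ) → (PBond (F.P K) 0 → Matrix (Fin 2) (Fin 2) ℂ) → PBond (F.P K) k → Matrix (Fin 2) (Fin 2) ℂ := fun k =>
    Nat.rec (motive := fun k => (PBond (F.P K) 0 → Matrix (Fin 2) (Fin 2) ℂ) → PBond (F.P K) k → Matrix (Fin 2) (Fin 2) ℂ) (fun Y => Y)
      (fun k Qk => fun Y c => fderiv ℂ (eml : (Idx (F.P K) → Matrix (Fin 2) (Fin 2) ℂ) → Matrix (Fin 2) (Fin 2) ℂ)
            (fun i => ((loopHol (Averaging.iter (fun i => blockAvg (P := F.P K) (j := i) (expMeanLogSU (n := Fin 2))) k W) c i : Matrix.specialUnitaryGroup (Fin 2) ℂ) : Matrix (Fin 2) (Fin 2) ℂ))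
            (fun i => covWalkSum (Averaging.iter (fun i => blockAvg (P := F.P K) (j := i) (expMeanLogSU (n := Fin 2))) k W) (Qk Y)
                (walk (emb c.src) (loopWord (F.P K).L c.dir (off i.1) i.2.1 i.2.2))
              * ((loopHol (Averaging.iter (fun i => blockAvg (P := F.P K) (j := i) (expMeanLogSU (n := Fin 2))) k W) c i : Matrix.specialUnitaryGroup (Fin 2) ℂ) : Matrix (Fin 2) (Fin 2) ℂ))
            * star ((corr (expMeanLogSU (n := Fin 2)) (Averaging.iter (fun i => blockAvg (P := F.P K) (j := i) (expMeanLogSU (n := Fin 2))) k W) c : Matrix.specialUnitaryGroup (Fin 2) ℂ) : Matrix (Fin 2) (Fin 2) ℂ)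
          + ((corr (expMeanLogSU (n := Fin 2)) (Averaging.iter (fun i => blockAvg (P := F.P K) (j := i) (expMeanLogSU (n := Fin 2))) k W) c : Matrix.specialUnitaryGroup (Fin 2) ℂ) : Matrix (Fin 2) (Fin 2) ℂ)
            * covWalkSum (Averaging.iter (fun i => blockAvg (P := F.P K) (j := i) (expMeanLogSU (n := Fin 2))) k W) (Qk Y)
                (walk (emb c.src) (List.replicate (F.P K).L (c.dir, true)))
            * star ((corr (expMeanLogSU (n := Fin 2)) (Averaging.iter (fun i => blockAvg (P := F.P K) (j := i) (expMeanLogSU (n := Fin 2))) k W) c : Matrix.specialUnitaryGroup (Fin 2) ℂ) : Matrix (Fin 2) (Fin 2) ℂ)) k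
  have hQ0 : ∀ Y, Qf 0 Y = Y := fun _ => rfl
  have hQs : ∀ (k : ℕ) (Y : PBond (F.P K) 0 → Matrix (Fin 2) (Fin 2) ℂ) (c : PBond (F.P K) (k + 1)), Qf (k + 1) Y c
      = fderiv ℂ (eml : (Idx (F.P K) → Matrix (Fin 2) (Fin 2) ℂ) → Matrix (Fin 2) (Fin 2) ℂ)
            (fun i => ((loopHol (Averaging.iter (fun i => blockAvg (P := F.P K) (j := i) (expMeanLogSU (n := Fin 2))) k W) c i : Matrix.specialUnitaryGroup (Fin 2) ℂ) : Matrix (Fin 2) (Fin 2) ℂ))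
            (fun i => covWalkSum (Averaging.iter (fun i => blockAvg (P := F.P K) (j := i) (expMeanLogSU (n := Fin 2))) k W) (Qf k Y)
                (walk (emb c.src) (loopWord (F.P K).L c.dir (off i.1) i.2.1 i.2.2))
              * ((loopHol (Averaging.iter (fun i => blockAvg (P := F.P K) (j := i) (expMeanLogSU (n := Fin 2))) k W) c i : Matrix.specialUnitaryGroup (Fin 2) ℂ) : Matrix (Fin 2) (Fin 2) ℂ))
            * star ((corr (expMeanLogSU (n := Fin 2)) (Averaging.iter (fun i => blockAvg (P := F.P K) (j := i) (expMeanLogSU (n := Fin 2))) k W) c : Matrix.specialUnitaryGroup (Fin 2) ℂ) : Matrix (Fin 2) (Fin 2) ℂ)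
          + ((corr (expMeanLogSU (n := Fin 2)) (Averaging.iter (fun i => blockAvg (P := F.P K) (j := i) (expMeanLogSU (n := Fin 2))) k W) c : Matrix.specialUnitaryGroup (Fin 2) ℂ) : Matrix (Fin 2) (Fin 2) ℂ)
            * covWalkSum (Averaging.iter (fun i => blockAvg (P := F.P K) (j := i) (expMeanLogSU (n := Fin 2))) k W) (Qf k Y)
                (walk (emb c.src) (List.replicate (F.P K).L (c.dir, true)))
            * star ((corr (expMeanLogSU (n := Fin 2)) (Averaging.iter (fun i => blockAvg (P := F.P K) (j := i) (expMeanLogSU (n := Fin 2))) k W) c : Matrix.specialUnitaryGroup (Fin 2) ℂ) : Matrix (Fin 2) (Fin 2) ℂ) := fun _ _ _ => rfl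
  obtain ⟨Λ, hΛ0, hΛs⟩ := exists_stairGauge_family F (K := K) W B
  let G : PBond (F.P K) (K - n) → Matrix (Fin 2) (Fin 2) ℂ := fun c =>
    ((fderiv ℂ (fun t : PBond (F.P K) 0 → Matrix (Fin 2) (Fin 2) ℂ =>
                (((emlIterU (K - n) (fun b' => expUnit (t b') * bgUnits F K W b') c : (Matrix (Fin 2) (Fin 2) ℂ)ˣ) : Matrix (Fin 2) (Fin 2) ℂ))) 0 B
              * star ((Averaging.iter (fun i => blockAvg (P := F.P K) (j := i) (expMeanLogSU (n := Fin 2))) (K - n) W c : Matrix.specialUnitaryGroup (Fin 2) ℂ) : Matrix (Fin 2) (Fin 2) ℂ))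
          - (Λ (K - n) c.src - ((Averaging.iter (fun i => blockAvg (P := F.P K) (j := i) (expMeanLogSU (n := Fin 2))) (K - n) W c : Matrix.specialUnitaryGroup (Fin 2) ℂ) : Matrix (Fin 2) (Fin 2) ℂ) * Λ (K - n) c.tgt * star ((Averaging.iter (fun i => blockAvg (P := F.P K) (j := i) (expMeanLogSU (n := Fin 2))) (K - n) W c : Matrix.specialUnitaryGroup (Fin 2) ℂ) : Matrix (Fin 2) (Fin 2) ℂ)))
  -- (R3): `QTwS W B c' = G ĉ`
  have hR3 : ∀ c' : PBond (F.P n) 0, QTwS F n K h W B c' = G (bondShift (sites_eq F n K h) c') := fun c' =>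
    QTwS_apply_eq_frameReduced_bondShift F h hε₀ hε hε12 W hreg Qf hQ0 hQs B hA htr Λ hΛ0 (fun k _ y => hΛs k y) c'
  -- (R2): `Σ_c ‖G c − S c‖² ≤ E₂'·Σ‖B‖²` and `16ℓ^{2d}E₂' ≤ (10¹¹L¹⁰ − 16·10⁹L⁴)ε₀²ℓ^dℓ²`
  set ρ : ℝ := Real.sqrt ((((F.P K).L : ℝ) ^ (F.P K).d)⁻¹ * ((F.P K).L : ℝ) ^ 2) with hρ
  set κ : ℝ := (159 * ((((F.P K).d + 2) * (F.P K).L : ℕ) : ℝ) * Real.sqrt (2 * (F.P K).d * ((F.P K).L : ℝ) ^ (F.P K).d * (2 * (F.P K).d))) with hκ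
  set Bc : ℝ := (((((F.P K).d + 2) * (F.P K).L : ℕ) : ℝ) ^ 2 / 16 * ε₀) with hBc
  have hρ0 : 0 < ρ := by rw [hρ]; exact Real.sqrt_pos.mpr (by have := (F.P K).L_pos; positivity)
  obtain ⟨h1, -⟩ := sqrt_sum_normSq_frameReduced_sub_lineIter_le_of_regPr F hε₀ hε hε12 W hreg Qf hQ0 hQs B hA htr Λ hΛ0
    (fun k _ y => hΛs k y) Sf (fun _ => rfl) (fun _ _ => rfl) (k := K - n) le_rfl
  rw [← hρ, ← hκ, ← hBc] at h1
  have hS2 : 0 ≤ ∑ c : PBond (F.P K) (K - n), ‖G c - Sf (K - n) c‖ ^ 2 := by positivity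
  have hN : 0 ≤ ∑ b : PBond (F.P K) 0, ‖B b‖ ^ 2 := by positivity
  have h2 : Real.sqrt (∑ c : PBond (F.P K) (K - n), ‖G c - Sf (K - n) c‖ ^ 2)
      ≤ (ρ⁻¹ * (ρ ^ (K - n) * κ * Bc * Real.exp (κ / ρ * Bc))) * Real.sqrt (∑ b : PBond (F.P K) 0, ‖B b‖ ^ 2) := by
    have h' := mul_le_mul_of_nonneg_left h1 (inv_nonneg.mpr hρ0.le)
    rw [← mul_assoc, inv_mul_cancel₀ hρ0.ne', one_mul, ← mul_assoc] at h'
    exact h'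
  have hR2 := pow_le_pow_left₀ (Real.sqrt_nonneg _) h2 2
  rw [Real.sq_sqrt hS2, mul_pow, Real.sq_sqrt hN] at hR2
  have hbc := bridgeConst_sq_le F n K hε₀ hε
  rw [← hρ, ← hκ, ← hBc] at hbc
  -- (R1): the (iv) row in op-norm letters
  have hR1 := sum_normSq_tubeStr_sub_smul_conjR_lineIter_le F hε₀ hε W hreg B Sf (fun _ => rfl) (fun _ _ => rfl)
  -- FILE A: the local gauge comparison of the tube functional, for `V = U₀^g` and `B^g`
  have hgood' : ∀ (c : PBond (F.P K) (K - n)) (r : Fin (F.P K).d → Fin ((F.P K).L ^ (K - n))) (t : ℕ), t < (F.P K).L ^ (K - n) →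
      Bg ⟨(fun z : Site (F.P K) 0 => z.shift c.dir)^[t] (Site.fibreSite 0 (K - n) c.src r), c.dir⟩ ≠ 0 →
        (∀ st ∈ walk (Site.fibreSite 0 (K - n) c.src fun _ => (⟨0, pow_pos (F.P K).L_pos (K - n)⟩ : Fin ((F.P K).L ^ (K - n)))) (treeWord fun ν => ((r ν : ℕ) : ℤ)), ‖(((gaugeActT g (unitsField (toUField W))) st.bond : (Matrix (Fin 2) (Fin 2) ℂ)ˣ) : Matrix (Fin 2) (Fin 2) ℂ) - 1‖ ≤ δ) ∧
        (∀ st ∈ walk (Site.fibreSite 0 (K - n) c.src r) (List.replicate t (c.dir, true)), ‖(((gaugeActT g (unitsField (toUField W))) st.bond : (Matrix (Fin 2) (Fin 2) ℂ)ˣ) : Matrix (Fin 2) (Fin 2) ℂ) - 1‖ ≤ δ) := by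
    intro c r t ht hne
    refine hgood c r t ht fun h0 => hne ?_
    show conjR _ _ = 0
    rw [h0, conjR_apply, mul_zero, zero_mul]
  have hFA := sum_normSq_tubeStr_sub_plain_le F (n := n) (K := K) (gaugeActT g (unitsField (toUField W))) hV1 hδ Bg hgood'
  have hBg2 : ∑ b : PBond (F.P K) 0, ‖Bg b‖ ^ 2 = ∑ b : PBond (F.P K) 0, ‖B b‖ ^ 2 := Finset.sum_congr rfl fun b _ => by rw [hBgn]
  rw [hBg2] at hFA
  -- the exact covariance `T_U B(c) = Ad_{g(x₀(c))}⁻¹ T_V B^g(c)`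
  have hcov : ∀ c : PBond (F.P K) (K - n), (∑ r : Fin (F.P K).d → Fin ((F.P K).L ^ (K - n)), ∑ t ∈ Finset.range ((F.P K).L ^ (K - n)),
        conjR (holT (unitsField (toUField W)) (Site.fibreSite 0 (K - n) c.src fun _ => (⟨0, pow_pos (F.P K).L_pos (K - n)⟩ : Fin ((F.P K).L ^ (K - n)))) (treeWord fun ν => ((r ν : ℕ) : ℤ))
            * holT (unitsField (toUField W)) (Site.fibreSite 0 (K - n) c.src r) (List.replicate t (c.dir, true)))
          (B ⟨(fun z : Site (F.P K) 0 => z.shift c.dir)^[t] (Site.fibreSite 0 (K - n) c.src r), c.dir⟩))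
      = conjR (g (Site.fibreSite 0 (K - n) c.src fun _ => (⟨0, pow_pos (F.P K).L_pos (K - n)⟩ : Fin ((F.P K).L ^ (K - n)))))⁻¹ (∑ r : Fin (F.P K).d → Fin ((F.P K).L ^ (K - n)), ∑ t ∈ Finset.range ((F.P K).L ^ (K - n)),
        conjR (holT (gaugeActT g (unitsField (toUField W))) (Site.fibreSite 0 (K - n) c.src fun _ => (⟨0, pow_pos (F.P K).L_pos (K - n)⟩ : Fin ((F.P K).L ^ (K - n)))) (treeWord fun ν => ((r ν : ℕ) : ℤ))
            * holT (gaugeActT g (unitsField (toUField W))) (Site.fibreSite 0 (K - n) c.src r) (List.replicate t (c.dir, true)))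
          (Bg ⟨(fun z : Site (F.P K) 0 => z.shift c.dir)^[t] (Site.fibreSite 0 (K - n) c.src r), c.dir⟩)) := by
    intro c
    rw [conjR_sum]
    refine Finset.sum_congr rfl fun r _ => ?_
    rw [conjR_sum]
    refine Finset.sum_congr rfl fun t _ => ?_
    have hend : transl (Site.fibreSite 0 (K - n) c.src fun _ => (⟨0, pow_pos (F.P K).L_pos (K - n)⟩ : Fin ((F.P K).L ^ (K - n)))) (disp (treeWord fun ν => ((r ν : ℕ) : ℤ))) = Site.fibreSite 0 (K - n) c.src r := by
      rw [← rel_corner_fibreSite hk c.src (pow_pos (F.P K).L_pos (K - n)) r, B10Eq27TorusAxialLog.transl_disp_treeWord_rel]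
    have hrun : transl (Site.fibreSite 0 (K - n) c.src r) (disp (List.replicate t (c.dir, true)))
        = (fun z : Site (F.P K) 0 => z.shift c.dir)^[t] (Site.fibreSite 0 (K - n) c.src r) := by
      rw [← Prop7TowerClosenessOfRegPr.walkEnd_eq_transl_disp', Prop7TubeTransportCloseness.walkEnd_replicate_true, iterate_shift_eq_runSite]
    have key := conjR_holT_mul_holT_eq_gauge (unitsField (toUField W)) g (Site.fibreSite 0 (K - n) c.src fun _ => (⟨0, pow_pos (F.P K).L_pos (K - n)⟩ : Fin ((F.P K).L ^ (K - n)))) (treeWord fun ν => ((r ν : ℕ) : ℤ)) (List.replicate t (c.dir, true))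
      (B ⟨(fun z : Site (F.P K) 0 => z.shift c.dir)^[t] (Site.fibreSite 0 (K - n) c.src r), c.dir⟩)
    rw [hend] at key
    rw [key, hrun]
  -- the scalar of §3 of FILE A is the real cast
  have hld : ((((F.P K).L : ℂ) ^ (K - n)) ^ (F.P K).d) = (((((F.L : ℝ) ^ (K - n)) ^ (F.P K).d : ℝ)) : ℂ) := by push_cast; rfl
  -- ★ per coarse bond `c'`: the three-error bound
  have hper : ∀ c' : PBond (F.P n) 0,
      ‖QTwS F n K h W B c'
        - conjR ((axialT (unitsField (toUField W)) (Site.fibreSite 0 (K - n) (bondShift (sites_eq F n K h) c').src fun _ => (⟨0, pow_pos (F.P K).L_pos (K - n)⟩ : Fin ((F.P K).L ^ (K - n)))) (embIter (K - n) (bondShift (sites_eq F n K h) c').src))⁻¹ * (g (Site.fibreSite 0 (K - n) (bondShift (sites_eq F n K h) c').src fun _ => (⟨0, pow_pos (F.P K).L_pos (K - n)⟩ : Fin ((F.P K).L ^ (K - n)))))⁻¹)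
            (QTwS F n K h (1 : GaugeField (F.P K) 0 (Matrix.specialUnitaryGroup (Fin 2) ℂ)) Bg c')‖ ^ 2
      ≤ ((((F.L : ℝ) ^ (K - n)) ^ (F.P K).d) ^ 2)⁻¹ * (3 * (‖(((((F.L : ℝ) ^ (K - n)) ^ (F.P K).d : ℝ)) : ℂ) • (G (bondShift (sites_eq F n K h) c') - Sf (K - n) (bondShift (sites_eq F n K h) c'))‖ ^ 2
          + ‖(∑ r : Fin (F.P K).d → Fin ((F.P K).L ^ (K - n)), ∑ t ∈ Finset.range ((F.P K).L ^ (K - n)),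
        conjR (holT (unitsField (toUField W)) (Site.fibreSite 0 (K - n) (bondShift (sites_eq F n K h) c').src fun _ => (⟨0, pow_pos (F.P K).L_pos (K - n)⟩ : Fin ((F.P K).L ^ (K - n)))) (treeWord fun ν => ((r ν : ℕ) : ℤ))
            * holT (unitsField (toUField W)) (Site.fibreSite 0 (K - n) (bondShift (sites_eq F n K h) c').src r) (List.replicate t ((bondShift (sites_eq F n K h) c').dir, true)))
          (B ⟨(fun z : Site (F.P K) 0 => z.shift (bondShift (sites_eq F n K h) c').dir)^[t] (Site.fibreSite 0 (K - n) (bondShift (sites_eq F n K h) c').src r), (bondShift (sites_eq F n K h) c').dir⟩)) - (((((F.L : ℝ) ^ (K - n)) ^ (F.P K).d : ℝ)) : ℂ) • conjR (axialT (unitsField (toUField W)) (Site.fibreSite 0 (K - n) (bondShift (sites_eq F n K h) c').src fun _ => (⟨0, pow_pos (F.P K).L_pos (K - n)⟩ : Fin ((F.P K).L ^ (K - n)))) (embIter (K - n) (bondShift (sites_eq F n K h) c').src)) (Sf (K - n) (bondShift (sites_eq F n K h) c'))‖ ^ 2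
          + ‖(∑ r : Fin (F.P K).d → Fin ((F.P K).L ^ (K - n)), ∑ t ∈ Finset.range ((F.P K).L ^ (K - n)),
        conjR (holT (gaugeActT g (unitsField (toUField W))) (Site.fibreSite 0 (K - n) (bondShift (sites_eq F n K h) c').src fun _ => (⟨0, pow_pos (F.P K).L_pos (K - n)⟩ : Fin ((F.P K).L ^ (K - n)))) (treeWord fun ν => ((r ν : ℕ) : ℤ))
            * holT (gaugeActT g (unitsField (toUField W))) (Site.fibreSite 0 (K - n) (bondShift (sites_eq F n K h) c').src r) (List.replicate t ((bondShift (sites_eq F n K h) c').dir, true)))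
          (Bg ⟨(fun z : Site (F.P K) 0 => z.shift (bondShift (sites_eq F n K h) c').dir)^[t] (Site.fibreSite 0 (K - n) (bondShift (sites_eq F n K h) c').src r), (bondShift (sites_eq F n K h) c').dir⟩)) - (∑ r : Fin (F.P K).d → Fin ((F.P K).L ^ (K - n)), ∑ t ∈ Finset.range ((F.P K).L ^ (K - n)),
        Bg ⟨(fun z : Site (F.P K) 0 => z.shift (bondShift (sites_eq F n K h) c').dir)^[t] (Site.fibreSite 0 (K - n) (bondShift (sites_eq F n K h) c').src r), (bondShift (sites_eq F n K h) c').dir⟩)‖ ^ 2)) := by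
    intro c'
    have hT := hcov (bondShift (sites_eq F n K h) c')
    have hPL := plainTube_eq_smul_QTwS_one F n K h Bg c'
    rw [hld] at hPL
    have h3 := normSq_three_error_le (hΦ1 (bondShift (sites_eq F n K h) c')) (hg1 (Site.fibreSite 0 (K - n) (bondShift (sites_eq F n K h) c').src fun _ => (⟨0, pow_pos (F.P K).L_pos (K - n)⟩ : Fin ((F.P K).L ^ (K - n))))) (((((F.L : ℝ) ^ (K - n)) ^ (F.P K).d : ℝ)) : ℂ) (G (bondShift (sites_eq F n K h) c')) (Sf (K - n) (bondShift (sites_eq F n K h) c')) _ _ _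
      (QTwS F n K h (1 : GaugeField (F.P K) 0 (Matrix.specialUnitaryGroup (Fin 2) ℂ)) Bg c') hT hPL
    have hsc : (((((F.L : ℝ) ^ (K - n)) ^ (F.P K).d : ℝ)) : ℂ) • G (bondShift (sites_eq F n K h) c') - conjR ((axialT (unitsField (toUField W)) (Site.fibreSite 0 (K - n) (bondShift (sites_eq F n K h) c').src fun _ => (⟨0, pow_pos (F.P K).L_pos (K - n)⟩ : Fin ((F.P K).L ^ (K - n)))) (embIter (K - n) (bondShift (sites_eq F n K h) c').src))⁻¹ * (g (Site.fibreSite 0 (K - n) (bondShift (sites_eq F n K h) c').src fun _ => (⟨0, pow_pos (F.P K).L_pos (K - n)⟩ : Fin ((F.P K).L ^ (K - n)))))⁻¹) ((((((F.L : ℝ) ^ (K - n)) ^ (F.P K).d : ℝ)) : ℂ) • QTwS F n K h (1 : GaugeField (F.P K) 0 (Matrix.specialUnitaryGroup (Fin 2) ℂ)) Bg c')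
        = (((((F.L : ℝ) ^ (K - n)) ^ (F.P K).d : ℝ)) : ℂ) • (G (bondShift (sites_eq F n K h) c') - conjR ((axialT (unitsField (toUField W)) (Site.fibreSite 0 (K - n) (bondShift (sites_eq F n K h) c').src fun _ => (⟨0, pow_pos (F.P K).L_pos (K - n)⟩ : Fin ((F.P K).L ^ (K - n)))) (embIter (K - n) (bondShift (sites_eq F n K h) c').src))⁻¹ * (g (Site.fibreSite 0 (K - n) (bondShift (sites_eq F n K h) c').src fun _ => (⟨0, pow_pos (F.P K).L_pos (K - n)⟩ : Fin ((F.P K).L ^ (K - n)))))⁻¹) (QTwS F n K h (1 : GaugeField (F.P K) 0 (Matrix.specialUnitaryGroup (Fin 2) ℂ)) Bg c')) := by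
      rw [conjR_smul, ← smul_sub]
    rw [hsc, norm_smul, mul_pow, Complex.norm_real, Real.norm_of_nonneg hℓd0.le] at h3
    rw [hR3 c']
    have hpos : (0 : ℝ) < (((F.L : ℝ) ^ (K - n)) ^ (F.P K).d) ^ 2 := by positivity
    rw [← div_eq_inv_mul, le_div_iff₀ hpos]
    linarith [h3]
  -- ★ sum over `c'`; the three global rows reindexed to the coarse bonds (`c ↦ ĉ = bondShift c'` is a bijection)
  refine (Finset.sum_le_sum fun c' (_ : c' ∈ Finset.univ) => hper c').trans ?_
  rw [← Finset.mul_sum, ← Finset.mul_sum, Finset.sum_add_distrib, Finset.sum_add_distrib]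
  have hR2' : ∑ c' : PBond (F.P n) 0, ‖G (bondShift (sites_eq F n K h) c') - Sf (K - n) (bondShift (sites_eq F n K h) c')‖ ^ 2
      ≤ (ρ⁻¹ * (ρ ^ (K - n) * κ * Bc * Real.exp (κ / ρ * Bc))) ^ 2 * ∑ b : PBond (F.P K) 0, ‖B b‖ ^ 2 :=
    (Fintype.sum_equiv (bondShift (sites_eq F n K h)) _ (fun c : PBond (F.P K) (K - n) => ‖G c - Sf (K - n) c‖ ^ 2) (fun _ => rfl)).trans_le hR2
  have hR1' : ∑ c' : PBond (F.P n) 0, ‖(∑ r : Fin (F.P K).d → Fin ((F.P K).L ^ (K - n)), ∑ t ∈ Finset.range ((F.P K).L ^ (K - n)),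
        conjR (holT (unitsField (toUField W)) (Site.fibreSite 0 (K - n) (bondShift (sites_eq F n K h) c').src fun _ => (⟨0, pow_pos (F.P K).L_pos (K - n)⟩ : Fin ((F.P K).L ^ (K - n)))) (treeWord fun ν => ((r ν : ℕ) : ℤ))
            * holT (unitsField (toUField W)) (Site.fibreSite 0 (K - n) (bondShift (sites_eq F n K h) c').src r) (List.replicate t ((bondShift (sites_eq F n K h) c').dir, true)))
          (B ⟨(fun z : Site (F.P K) 0 => z.shift (bondShift (sites_eq F n K h) c').dir)^[t] (Site.fibreSite 0 (K - n) (bondShift (sites_eq F n K h) c').src r), (bondShift (sites_eq F n K h) c').dir⟩)) - (((((F.L : ℝ) ^ (K - n)) ^ (F.P K).d : ℝ)) : ℂ) • conjR (axialT (unitsField (toUField W)) (Site.fibreSite 0 (K - n) (bondShift (sites_eq F n K h) c').src fun _ => (⟨0, pow_pos (F.P K).L_pos (K - n)⟩ : Fin ((F.P K).L ^ (K - n)))) (embIter (K - n) (bondShift (sites_eq F n K h) c').src)) (Sf (K - n) (bondShift (sites_eq F n K h) c'))‖ ^ 2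
      ≤ 10 ^ 9 * (F.L : ℝ) ^ 4 * ε₀ ^ 2 * ((((F.L : ℝ) ^ (K - n)) ^ (F.P K).d) * (((F.L : ℝ) ^ (K - n)) ^ 2)) * ∑ b : PBond (F.P K) 0, ‖B b‖ ^ 2 :=
    (Fintype.sum_equiv (bondShift (sites_eq F n K h)) _ (fun c : PBond (F.P K) (K - n) => ‖(∑ r : Fin (F.P K).d → Fin ((F.P K).L ^ (K - n)), ∑ t ∈ Finset.range ((F.P K).L ^ (K - n)),
        conjR (holT (unitsField (toUField W)) (Site.fibreSite 0 (K - n) c.src fun _ => (⟨0, pow_pos (F.P K).L_pos (K - n)⟩ : Fin ((F.P K).L ^ (K - n)))) (treeWord fun ν => ((r ν : ℕ) : ℤ))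
            * holT (unitsField (toUField W)) (Site.fibreSite 0 (K - n) c.src r) (List.replicate t (c.dir, true)))
          (B ⟨(fun z : Site (F.P K) 0 => z.shift c.dir)^[t] (Site.fibreSite 0 (K - n) c.src r), c.dir⟩)) - (((((F.L : ℝ) ^ (K - n)) ^ (F.P K).d : ℝ)) : ℂ) • conjR (axialT (unitsField (toUField W)) (Site.fibreSite 0 (K - n) c.src fun _ => (⟨0, pow_pos (F.P K).L_pos (K - n)⟩ : Fin ((F.P K).L ^ (K - n)))) (embIter (K - n) c.src)) (Sf (K - n) c)‖ ^ 2) (fun _ => rfl)).trans_le hR1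
  have hFA' : ∑ c' : PBond (F.P n) 0, ‖(∑ r : Fin (F.P K).d → Fin ((F.P K).L ^ (K - n)), ∑ t ∈ Finset.range ((F.P K).L ^ (K - n)),
        conjR (holT (gaugeActT g (unitsField (toUField W))) (Site.fibreSite 0 (K - n) (bondShift (sites_eq F n K h) c').src fun _ => (⟨0, pow_pos (F.P K).L_pos (K - n)⟩ : Fin ((F.P K).L ^ (K - n)))) (treeWord fun ν => ((r ν : ℕ) : ℤ))
            * holT (gaugeActT g (unitsField (toUField W))) (Site.fibreSite 0 (K - n) (bondShift (sites_eq F n K h) c').src r) (List.replicate t ((bondShift (sites_eq F n K h) c').dir, true)))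
          (Bg ⟨(fun z : Site (F.P K) 0 => z.shift (bondShift (sites_eq F n K h) c').dir)^[t] (Site.fibreSite 0 (K - n) (bondShift (sites_eq F n K h) c').src r), (bondShift (sites_eq F n K h) c').dir⟩)) - (∑ r : Fin (F.P K).d → Fin ((F.P K).L ^ (K - n)), ∑ t ∈ Finset.range ((F.P K).L ^ (K - n)),
        Bg ⟨(fun z : Site (F.P K) 0 => z.shift (bondShift (sites_eq F n K h) c').dir)^[t] (Site.fibreSite 0 (K - n) (bondShift (sites_eq F n K h) c').src r), (bondShift (sites_eq F n K h) c').dir⟩)‖ ^ 2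
      ≤ (2 * (((F.P K).d + 1) * (F.L : ℝ) ^ (K - n)) * δ) ^ 2 * ((((F.L : ℝ) ^ (K - n)) ^ (F.P K).d) * (((F.L : ℝ) ^ (K - n)) ^ 2))
          * ∑ b : PBond (F.P K) 0, ‖B b‖ ^ 2 :=
    (Fintype.sum_equiv (bondShift (sites_eq F n K h)) _ (fun c : PBond (F.P K) (K - n) => ‖(∑ r : Fin (F.P K).d → Fin ((F.P K).L ^ (K - n)), ∑ t ∈ Finset.range ((F.P K).L ^ (K - n)),
        conjR (holT (gaugeActT g (unitsField (toUField W))) (Site.fibreSite 0 (K - n) c.src fun _ => (⟨0, pow_pos (F.P K).L_pos (K - n)⟩ : Fin ((F.P K).L ^ (K - n)))) (treeWord fun ν => ((r ν : ℕ) : ℤ))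
            * holT (gaugeActT g (unitsField (toUField W))) (Site.fibreSite 0 (K - n) c.src r) (List.replicate t (c.dir, true)))
          (Bg ⟨(fun z : Site (F.P K) 0 => z.shift c.dir)^[t] (Site.fibreSite 0 (K - n) c.src r), c.dir⟩)) - (∑ r : Fin (F.P K).d → Fin ((F.P K).L ^ (K - n)), ∑ t ∈ Finset.range ((F.P K).L ^ (K - n)),
        Bg ⟨(fun z : Site (F.P K) 0 => z.shift c.dir)^[t] (Site.fibreSite 0 (K - n) c.src r), c.dir⟩)‖ ^ 2) (fun _ => rfl)).trans_le hFA
  have hX1 : ∑ c' : PBond (F.P n) 0, ‖(((((F.L : ℝ) ^ (K - n)) ^ (F.P K).d : ℝ)) : ℂ) • (G (bondShift (sites_eq F n K h) c') - Sf (K - n) (bondShift (sites_eq F n K h) c'))‖ ^ 2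
      = (((F.L : ℝ) ^ (K - n)) ^ (F.P K).d) ^ 2 * ∑ c' : PBond (F.P n) 0, ‖G (bondShift (sites_eq F n K h) c') - Sf (K - n) (bondShift (sites_eq F n K h) c')‖ ^ 2 := by
    rw [Finset.mul_sum]
    refine Finset.sum_congr rfl fun c' _ => ?_
    rw [norm_smul, mul_pow, Complex.norm_real, Real.norm_of_nonneg hℓd0.le]
  rw [hX1]
  have hd8 : (2 * ((((F.P K).d : ℝ) + 1) * (F.L : ℝ) ^ (K - n)) * δ) ^ 2 = 64 * ((F.L : ℝ) ^ (K - n) * δ) ^ 2 := by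
    rw [show (((F.P K).d : ℝ)) = 3 by exact_mod_cast hd]; ring
  rw [hd8] at hFA'
  -- assemble the numbers
  have hP0 : 0 ≤ ε₀ ^ 2 * ((((F.L : ℝ) ^ (K - n)) ^ (F.P K).d) * (((F.L : ℝ) ^ (K - n)) ^ 2)) * ∑ b : PBond (F.P K) 0, ‖B b‖ ^ 2 := by positivity
  have hL4 : (F.L : ℝ) ^ 4 ≤ (F.L : ℝ) ^ 10 := pow_le_pow_right₀ (by linarith) (by norm_num)
  have hL4P := mul_le_mul_of_nonneg_right hL4 hP0
  have hG2 : (((F.L : ℝ) ^ (K - n)) ^ (F.P K).d) ^ 2 * ∑ c' : PBond (F.P n) 0, ‖G (bondShift (sites_eq F n K h) c') - Sf (K - n) (bondShift (sites_eq F n K h) c')‖ ^ 2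
      ≤ (((F.L : ℝ) ^ (K - n)) ^ (F.P K).d) ^ 2 * ((ρ⁻¹ * (ρ ^ (K - n) * κ * Bc * Real.exp (κ / ρ * Bc))) ^ 2 * ∑ b : PBond (F.P K) 0, ‖B b‖ ^ 2) :=
    mul_le_mul_of_nonneg_left hR2' (by positivity)
  have hbcN := mul_le_mul_of_nonneg_right hbc hN
  have hkey : 3 * ((((F.L : ℝ) ^ (K - n)) ^ (F.P K).d) ^ 2 * ∑ c' : PBond (F.P n) 0, ‖G (bondShift (sites_eq F n K h) c') - Sf (K - n) (bondShift (sites_eq F n K h) c')‖ ^ 2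
        + ∑ c' : PBond (F.P n) 0, ‖(∑ r : Fin (F.P K).d → Fin ((F.P K).L ^ (K - n)), ∑ t ∈ Finset.range ((F.P K).L ^ (K - n)),
        conjR (holT (unitsField (toUField W)) (Site.fibreSite 0 (K - n) (bondShift (sites_eq F n K h) c').src fun _ => (⟨0, pow_pos (F.P K).L_pos (K - n)⟩ : Fin ((F.P K).L ^ (K - n)))) (treeWord fun ν => ((r ν : ℕ) : ℤ))
            * holT (unitsField (toUField W)) (Site.fibreSite 0 (K - n) (bondShift (sites_eq F n K h) c').src r) (List.replicate t ((bondShift (sites_eq F n K h) c').dir, true)))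
          (B ⟨(fun z : Site (F.P K) 0 => z.shift (bondShift (sites_eq F n K h) c').dir)^[t] (Site.fibreSite 0 (K - n) (bondShift (sites_eq F n K h) c').src r), (bondShift (sites_eq F n K h) c').dir⟩)) - (((((F.L : ℝ) ^ (K - n)) ^ (F.P K).d : ℝ)) : ℂ) • conjR (axialT (unitsField (toUField W)) (Site.fibreSite 0 (K - n) (bondShift (sites_eq F n K h) c').src fun _ => (⟨0, pow_pos (F.P K).L_pos (K - n)⟩ : Fin ((F.P K).L ^ (K - n)))) (embIter (K - n) (bondShift (sites_eq F n K h) c').src)) (Sf (K - n) (bondShift (sites_eq F n K h) c'))‖ ^ 2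
        + ∑ c' : PBond (F.P n) 0, ‖(∑ r : Fin (F.P K).d → Fin ((F.P K).L ^ (K - n)), ∑ t ∈ Finset.range ((F.P K).L ^ (K - n)),
        conjR (holT (gaugeActT g (unitsField (toUField W))) (Site.fibreSite 0 (K - n) (bondShift (sites_eq F n K h) c').src fun _ => (⟨0, pow_pos (F.P K).L_pos (K - n)⟩ : Fin ((F.P K).L ^ (K - n)))) (treeWord fun ν => ((r ν : ℕ) : ℤ))
            * holT (gaugeActT g (unitsField (toUField W))) (Site.fibreSite 0 (K - n) (bondShift (sites_eq F n K h) c').src r) (List.replicate t ((bondShift (sites_eq F n K h) c').dir, true)))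
          (Bg ⟨(fun z : Site (F.P K) 0 => z.shift (bondShift (sites_eq F n K h) c').dir)^[t] (Site.fibreSite 0 (K - n) (bondShift (sites_eq F n K h) c').src r), (bondShift (sites_eq F n K h) c').dir⟩)) - (∑ r : Fin (F.P K).d → Fin ((F.P K).L ^ (K - n)), ∑ t ∈ Finset.range ((F.P K).L ^ (K - n)),
        Bg ⟨(fun z : Site (F.P K) 0 => z.shift (bondShift (sites_eq F n K h) c').dir)^[t] (Site.fibreSite 0 (K - n) (bondShift (sites_eq F n K h) c').src r), (bondShift (sites_eq F n K h) c').dir⟩)‖ ^ 2)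
      ≤ (3 * 10 ^ 10 * (F.L : ℝ) ^ 10 * ε₀ ^ 2 + 192 * ((F.L : ℝ) ^ (K - n) * δ) ^ 2)
          * ((((F.L : ℝ) ^ (K - n)) ^ (F.P K).d) * (((F.L : ℝ) ^ (K - n)) ^ 2)) * ∑ b : PBond (F.P K) 0, ‖B b‖ ^ 2 := by
    have hS1 : 3 * ((((F.L : ℝ) ^ (K - n)) ^ (F.P K).d) ^ 2 * ∑ c' : PBond (F.P n) 0, ‖G (bondShift (sites_eq F n K h) c') - Sf (K - n) (bondShift (sites_eq F n K h) c')‖ ^ 2)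
        ≤ 3 / 16 * ((10 ^ 11 * (F.L : ℝ) ^ 10 - 16 * 10 ^ 9 * (F.L : ℝ) ^ 4) * (ε₀ ^ 2 * ((((F.L : ℝ) ^ (K - n)) ^ (F.P K).d) * (((F.L : ℝ) ^ (K - n)) ^ 2))) * (∑ b : PBond (F.P K) 0, ‖B b‖ ^ 2)) := by
      linarith [hG2, hbcN]
    have hP10 : 0 ≤ (F.L : ℝ) ^ 10 * (ε₀ ^ 2 * ((((F.L : ℝ) ^ (K - n)) ^ (F.P K).d) * (((F.L : ℝ) ^ (K - n)) ^ 2)) * (∑ b : PBond (F.P K) 0, ‖B b‖ ^ 2)) := by positivity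
    have hP4 : 0 ≤ (F.L : ℝ) ^ 4 * (ε₀ ^ 2 * ((((F.L : ℝ) ^ (K - n)) ^ (F.P K).d) * (((F.L : ℝ) ^ (K - n)) ^ 2)) * (∑ b : PBond (F.P K) 0, ‖B b‖ ^ 2)) := by positivity
    have hQ0 : 0 ≤ ((F.L : ℝ) ^ (K - n) * δ) ^ 2 * ((((F.L : ℝ) ^ (K - n)) ^ (F.P K).d) * (((F.L : ℝ) ^ (K - n)) ^ 2)) * (∑ b : PBond (F.P K) 0, ‖B b‖ ^ 2) := by positivity
    linarith [hS1, hR1', hFA', hP10, hP4, hQ0]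
  have hinv : ((((F.L : ℝ) ^ (K - n)) ^ (F.P K).d) ^ 2)⁻¹ * ((3 * 10 ^ 10 * (F.L : ℝ) ^ 10 * ε₀ ^ 2 + 192 * ((F.L : ℝ) ^ (K - n) * δ) ^ 2)
          * ((((F.L : ℝ) ^ (K - n)) ^ (F.P K).d) * (((F.L : ℝ) ^ (K - n)) ^ 2)) * ∑ b : PBond (F.P K) 0, ‖B b‖ ^ 2)
      = (3 * 10 ^ 10 * (F.L : ℝ) ^ 10 * ε₀ ^ 2 + 192 * ((F.L : ℝ) ^ (K - n) * δ) ^ 2)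
          * (((F.L : ℝ) ^ (K - n)) ^ 2 / ((F.L : ℝ) ^ (K - n)) ^ (F.P K).d) * ∑ b : PBond (F.P K) 0, ‖B b‖ ^ 2 := by
    field_simp
  rw [← hinv]
  exact mul_le_mul_of_nonneg_left hkey (by positivity)

end Summit.QuantumFields.YangMills.Theorems.Prop7QTwSLocalGaugeComparison

end
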